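import Summits.QuantumFields.BalabanUV.T4Continuum.Support.VariationalCovariantEndRel
import Summits.QuantumFields.BalabanUV.T4Continuum.Support.VariationalCovariantLipschitzRepair

/-!
# T⁴ programme, spine node NE2 (U1a), lane P2 — THE TWO-RUNS END (the skeleton's root R, §0): `TowerLimitRate (fun _ ↦ 1) 1
# (k ↦ X_k(run k)) C ρ₀`, `ρ₀ = max(L⁻¹, θ)`, for a tower whose level-k member is the effective covariant Laplacian of the k-th RUN's data
# `(Rc k, T k)` and whose level `k+1` is the `k+1`-st run's canonical pair over ITS OWN coarse partner `(Rb k, Tb k)`, the two runs tied at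
# level k ONLY by the RAW distances `n·‖Rb k − Rc k‖ ≤ c_ρ·θ^k`, `‖Tb k − T k‖ ≤ c_τ·θ^k` (node NE3's currency — a HYPOTHESIS here)
# (road owner `b2b-balaban-t4-ne2-p2` gen 11; `t4/skeletons/NE2-t4-ne2-p2.md` v0.12 §0 R / §2.D-bis (iii) / §3)

MECHANISM.  Per level: the canonical-pair bracket of run `k+1` (`VariationalCovariantScalarPairClosedRel.scalar_pair_closed_rel`, UB⁺ relative
to a reference transport — every leaf discharged, defects `eLevel`/`ePLevel`) between `Δ_k(Rb k, Tb k)` and `Δ_{k+1}(Rc (k+1), T (k+1))`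
(COMP⁺ for run `k+1`: `T (k+1) = compT (Tb k) (T′ k)`, `Rc (k+1) = Rtr (R′ k)`), PLUS the two-runs face at level k by CONSTRAINT REPAIR
(`VariationalCovariantLipschitzRepair.scalar_repair_abs`: `|Δ_k(Rb k,Tb k)(μ) − Δ_k(Rc k,T k)(μ)| ≤ e_L·nsq μ`, `e_L = eFED-shape at
δ₀ = √d·(nρ) + √Λ·τ`, NO rephasing — N-ne2p2g11-3 resolved) ⟹ level brackets with defects `e + e_L`, `e′ + e_L` ⟹ leaf-02-g3's
`towerLimitRate_effSc`.  Rates: `eLevel, ePLevel ≤ cEnd·(L⁻¹)^k` (`VariationalCovariantEnd.level_defects_le`), `e_L ≤ E_L·θ^k`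
(`VariationalCovariantRate.eFED_le`), both `≤ (cEnd + E_L)·ρ₀^k`.

HONEST FRAMING (T4-DAG p. 1).  Rung (B)+1 only — NOT infinite volume, NOT a mass gap, NOT Clay.  NE2 is NOT IN PRINT and NOT proved here.
MODEL LEVEL: all phases / transports / frames / defects are DATA (U(1) charged scalar = King's (2.14) species WITH background; global small
field for the pair's P⁺; the two-run distances `ρ_k`, `τ_k` with their rate `θ` are HYPOTHESES in node NE3's currency — leaf-09-g4's adapters
`VariationalCovariantTwoRuns(NE3)` p214418/p214459 produce them from `T4EtaRateMin.LocalRate`; NE3 itself OPEN); leaf UB⁺ and P⁺ for the run-k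
data `(Rc k, T k)` are taken in LEAF SHAPE (suppliers: `exists_ub_scalarPair_rel_eff` p214899, `qW_le_coarse(_rel)` p211992/p215015).  Plumbing,
[folklore]; no `def … : Prop`; no `sorry`; axioms standard.  HONEST DEPENDENCY (cell, verbatim): continuum YM on T⁴ ⇐ BetaPertH ∧ nine spine
estimates (0/9 proved); BetaPertH ⇐ (D1) ∧ (D4) ∧ CAP+tail; G-an2-4 gates asym, D1 and NE2/3/4.
-/

noncomputable section

open scoped Matrix ComplexConjugate ComplexOrder Matrix.Norms.L2Operator BigOperators

namespace Summit.QuantumFields.BalabanUV.T4Continuum.VariationalCovariantTwoRunsEnd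

open Summit.QuantumFields.BalabanUV.T4Continuum.VariationalTransfer (blockSpin)
open Summit.QuantumFields.BalabanUV.T4Continuum.VariationalCovariantEffective (effSc)
open Summit.QuantumFields.BalabanUV.T4Continuum.VariationalCovariantTower (compT Rtr blockSpin_pair_transport towerLimitRate_effSc)
open Summit.QuantumFields.BalabanUV.T4Continuum.VariationalCovariantTowerLaw (eFED eONE eUB eFED_nonneg)
open Summit.QuantumFields.BalabanUV.T4Continuum.VariationalCovariantRate (eFED_le LamC_le)
open Summit.QuantumFields.BalabanUV.T4Continuum.VariationalCovariantEnd
  (lamC cR lamF delta eps1 deltaP lamLevel eLevel ePLevel cEnd lamC_nonneg cEnd_nonneg level_facts level_defects_le)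
open Summit.QuantumFields.BalabanUV.T4Continuum.VariationalCovariantScalarPairClosedRel (scalar_pair_closed_rel)
open Summit.QuantumFields.BalabanUV.T4Continuum.VariationalCovariantUpperBoundRel (exists_ub_scalarPair_rel_eff)
open Summit.QuantumFields.BalabanUV.T4Continuum.VariationalCovariantLipschitzRepair (scalar_repair_abs)
open Summit.QuantumFields.BalabanUV.T4Continuum.CovariantAveragingTower (TowerLimitRate)
open Summit.QuantumFields.BalabanUV.T4Continuum.VariationalCovariantFederbush (mis)
open Literature.MathematicalPhysics.QuantumFieldTheory.Balaban1983to89.B5Prop11Lower (nsq nsq_nonneg)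
open Literature.MathematicalPhysics.QuantumFieldTheory.Balaban1983to89.B5Prop11Plancherel (Tor fine unitVec)
open Literature.MathematicalPhysics.QuantumFieldTheory.Balaban1983to89.B5Block118 (bpt)
open Summit.QuantumFields.BalabanUV.T4Continuum.VariationalCovariantScalarPair (Sc Sf qW Qk Q1 qW_le_coarse)

variable {d : ℕ}

/-! ## §1 The two-runs defect constant and its rate -/

/-- the level-k two-runs defect of the repair face: `e_L = 2·(δ₀√(C_P(Λ+1)))·√Λ + (δ₀√(C_P(Λ+1)))²`, `C_P = 1088d + 128`,
`δ₀ = √d·(nρ) + √Λ·τ` (`scalar_repair_abs`'s constant). [folklore] -/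
def eLip (d : ℕ) (Λ δ₀ : ℝ) : ℝ :=
  2 * (δ₀ * Real.sqrt ((1088 * (d : ℝ) + 128) * (Λ + 1))) * Real.sqrt Λ + (δ₀ * Real.sqrt ((1088 * (d : ℝ) + 128) * (Λ + 1))) ^ 2

/-- `e_L` IS leaf-02-g3's `eFED d δ₀ Λ` (as real numbers). [folklore] -/
theorem eLip_eq_eFED (d : ℕ) {Λ δ₀ : ℝ} (hΛ : 0 ≤ Λ) : eLip d Λ δ₀ = eFED d δ₀ Λ := by
  unfold eLip eFED
  have hC : (0 : ℝ) ≤ (1088 * (d : ℝ) + 128) * (Λ + 1) := by positivity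
  rw [mul_pow, Real.sq_sqrt hC]
  have : Real.sqrt (Λ * ((1088 * (d : ℝ) + 128) * (Λ + 1))) = Real.sqrt Λ * Real.sqrt ((1088 * (d : ℝ) + 128) * (Λ + 1)) :=
    Real.sqrt_mul hΛ _
  rw [this]; ring

/-- the k-uniform two-runs constant `E_L(d, c_w′, c_ρ, c_τ) = eFED d (√d·c_ρ + √Λc⋆·c_τ) Λc⋆`, `Λc⋆ = lamC d c_w′`. [folklore] -/
def cLip (d : ℕ) (cw cρ cτ : ℝ) : ℝ := eFED d (Real.sqrt (d : ℝ) * cρ + Real.sqrt (lamC d cw) * cτ) (lamC d cw)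

/-- **THE TWO-RUNS RATE CONSTANT** `C = cEnd + E_L`. [folklore] -/
def cTwoRuns (d L : ℕ) (cw ca cm c₁ cρ cτ : ℝ) : ℝ := cEnd d L cw ca cm c₁ + cLip d cw cρ cτ

/-- per-level rate of the repair defect: with `Λ = lamC d (n·w)`, `n·w ≤ c_w`, `n·ρ ≤ c_ρ·t`, `τ ≤ c_τ·t`, `0 ≤ t ≤ 1`:
`e_L ≤ E_L·t`. [folklore] -/
theorem eLip_le {n w ρ τ cw cρ cτ t : ℝ} (hn : 0 ≤ n) (hw : 0 ≤ w) (hwc : n * w ≤ cw) (hρ : 0 ≤ ρ) (hτ : 0 ≤ τ)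
    (ht0 : 0 ≤ t) (ht1 : t ≤ 1) (hρc : n * ρ ≤ cρ * t) (hτc : τ ≤ cτ * t) :
    eLip d (lamC d (n * w)) (Real.sqrt (d : ℝ) * (n * ρ) + Real.sqrt (lamC d (n * w)) * τ) ≤ cLip d cw cρ cτ * t := by
  have hΛ0 : 0 ≤ lamC d (n * w) := lamC_nonneg d _
  have hΛ : lamC d (n * w) ≤ lamC d cw := by unfold lamC; exact LamC_le (mul_nonneg hn hw) hwc
  rw [eLip_eq_eFED d hΛ0]
  unfold cLip eFED
  have hδ0 : 0 ≤ Real.sqrt (d : ℝ) * (n * ρ) + Real.sqrt (lamC d (n * w)) * τ := by positivity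
  have hδ : Real.sqrt (d : ℝ) * (n * ρ) + Real.sqrt (lamC d (n * w)) * τ ≤ (Real.sqrt (d : ℝ) * cρ + Real.sqrt (lamC d cw) * cτ) * t := by
    have h1 : Real.sqrt (d : ℝ) * (n * ρ) ≤ Real.sqrt (d : ℝ) * (cρ * t) := mul_le_mul_of_nonneg_left hρc (Real.sqrt_nonneg _)
    have h2 : Real.sqrt (lamC d (n * w)) * τ ≤ Real.sqrt (lamC d cw) * (cτ * t) :=
      mul_le_mul (Real.sqrt_le_sqrt hΛ) hτc hτ (Real.sqrt_nonneg _)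
    linarith
  exact eFED_le hδ0 hδ ht0 ht1 hΛ0 hΛ (by positivity)

/-! ## §2 The two-runs tower from per-level brackets -/

section Tower

variable (L : ℕ) [NeZero L] (M : Fin d → ℕ) [hM : ∀ μ, NeZero (M μ)]
variable (Rc Rb : (k : ℕ) → Tor (fine (L ^ k) M) → Fin d → ℂ) (T Tb : (k : ℕ) → Tor (fine (L ^ k) M) → ℂ)
variable (R' : (k : ℕ) → Tor (fine L (fine (L ^ k) M)) → Fin d → ℂ) (T' : (k : ℕ) → Tor (fine L (fine (L ^ k) M)) → ℂ)

/-- **TWO-RUNS TOWER FROM BRACKETS**: per level, the canonical-pair brackets of run `k+1` over its coarse partner `(Rb k, Tb k)` with defects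
`e k, e′ k`, the two-runs face `|Δ_k(Rb k,Tb k) − Δ_k(Rc k,T k)| ≤ eL k·nsq` and COMP⁺ for run `k+1`; rates `e k + eL k, e′ k + eL k ≤ C·ρ₀^k`
⟹ `TowerLimitRate (fun _ ↦ 1) 1 (k ↦ effSc (L^k) M (Rc k) (T k) a₀) C ρ₀`. [folklore] -/
theorem towerLimitRate_twoRuns_of_brackets (hT : ∀ k x, ‖T k x‖ = 1) {CP' : ℕ → ℝ}
    (hPc : ∀ k f, qW (L ^ k) M f ≤ CP' k * (Sc (L ^ k) M (Rc k) f + nsq (Qk (L ^ k) M (T k) f)))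
    (hTcomp : ∀ k, T (k + 1) = compT (L ^ k) L M (Tb k) (T' k)) (hRtr : ∀ k, Rc (k + 1) = Rtr (L ^ k) L M (R' k))
    {a₀ : ℝ} (ha₀ : 0 < a₀) {C ρ₀ : ℝ} (hC : 0 ≤ C) (hρ₀ : 0 ≤ ρ₀) (hρ₀1 : ρ₀ < 1) (e e' eL : ℕ → ℝ)
    (he : ∀ k, e k + eL k ≤ C * ρ₀ ^ k) (he' : ∀ k, e' k + eL k ≤ C * ρ₀ ^ k)
    (hpair : ∀ k μ, blockSpin (Qk (L ^ k) M (Tb k)) (Sc (L ^ k) M (Rb k)) μ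
        ≤ blockSpin (Qk (L ^ k) M (Tb k) ∘ Q1 (L ^ k) L M (T' k)) (Sf (L ^ k) L M (R' k)) μ + e k * nsq μ ∧
      blockSpin (Qk (L ^ k) M (Tb k) ∘ Q1 (L ^ k) L M (T' k)) (Sf (L ^ k) L M (R' k)) μ
        ≤ blockSpin (Qk (L ^ k) M (Tb k)) (Sc (L ^ k) M (Rb k)) μ + e' k * nsq μ)
    (hlip : ∀ k μ, |blockSpin (Qk (L ^ k) M (Tb k)) (Sc (L ^ k) M (Rb k)) μ - blockSpin (Qk (L ^ k) M (T k)) (Sc (L ^ k) M (Rc k)) μ|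
        ≤ eL k * nsq μ) :
    TowerLimitRate (ι := fun _ => Tor M) (fun _ => (1 : Matrix (Tor M) (Tor M) ℂ)) 1
      (fun k => effSc (L ^ k) M (Rc k) (T k) a₀) C ρ₀ := by
  refine towerLimitRate_effSc L M Rc T hT hPc ha₀ hC hρ₀ hρ₀1 fun k μ => ?_
  have hlev : blockSpin (Qk (L ^ (k + 1)) M (T (k + 1))) (Sc (L ^ (k + 1)) M (Rc (k + 1))) μ
      = blockSpin (Qk (L ^ k) M (Tb k) ∘ Q1 (L ^ k) L M (T' k)) (Sf (L ^ k) L M (R' k)) μ := by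
    have e1 : blockSpin (Qk (L ^ (k + 1)) M (T (k + 1))) (Sc (L ^ (k + 1)) M (Rc (k + 1))) μ
        = blockSpin (Qk (L ^ k * L) M (compT (L ^ k) L M (Tb k) (T' k))) (Sc (L ^ k * L) M (Rtr (L ^ k) L M (R' k))) μ := by
      rw [hTcomp k, hRtr k]; rfl
    rw [e1, ← blockSpin_pair_transport]
  rw [hlev]
  have hp := hpair k μ
  have hl := abs_le.mp (hlip k μ)
  have hn : 0 ≤ nsq μ := nsq_nonneg μ
  have h1 : (e k + eL k) * nsq μ ≤ C * ρ₀ ^ k * nsq μ := mul_le_mul_of_nonneg_right (he k) hn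
  have h2 : (e' k + eL k) * nsq μ ≤ C * ρ₀ ^ k * nsq μ := mul_le_mul_of_nonneg_right (he' k) hn
  constructor
  · nlinarith [hp.1, hl.1, hl.2, h1]
  · nlinarith [hp.2, hl.1, hl.2, h2]

end Tower

/-! ## §3 THE TWO-RUNS END: every per-level leaf discharged; NE3's currency as the two-run CLASS -/

section Closed

variable (L : ℕ) [NeZero L] (M : Fin d → ℕ) [hM : ∀ μ, NeZero (M μ)]
variable (Rc Rb : (k : ℕ) → Tor (fine (L ^ k) M) → Fin d → ℂ) (T Tb Tb₀ : (k : ℕ) → Tor (fine (L ^ k) M) → ℂ)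
variable (R' : (k : ℕ) → Tor (fine L (fine (L ^ k) M)) → Fin d → ℂ) (T' : (k : ℕ) → Tor (fine L (fine (L ^ k) M)) → ℂ)
variable (G : (k : ℕ) → Tor (fine (L ^ k) M) → ℂ) (c : (k : ℕ) → Tor M → ℂ) (mG mB : ℕ → ℝ)
variable (G' : (k : ℕ) → Tor (fine L (fine (L ^ k) M)) → ℂ) (c' : (k : ℕ) → Tor (fine (L ^ k) M) → ℂ) (mG' mB' : ℕ → ℝ)
variable (m w w' a m₁ ρ τ : ℕ → ℝ)

/-- **THE TWO-RUNS END (P2, scalar covariant species, model level).**  Level `k` carries the k-th run's data `(Rc k, T k)` (unit modulus;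
leaf UB⁺ with constant `lamC d (n·w′_k)` and leaf P⁺ with `C_P = 1088d + 128` in LEAF SHAPE) and the `k+1`-st run's COARSE PARTNER
`(Rb k, Tb k)` with ITS canonical pair `(R′ k, T′ k)` (COMP⁺ for run `k+1`: `T (k+1) = compT (Tb k) (T′ k)`, `Rc (k+1) = Rtr (R′ k)`), the
pair's data exactly as in `scalar_pair_closed_rel` (frames, mismatch, reference transports `Tb₀ k` with in-block defect `w k` and relative phase
`γ`, plaquette defect, one-step defects, fictitious `w′ k`), the pair's CLASS (`n·w′_k ≤ c_w′`, `a_k·n² ≤ c_a`, `n²·m_k ≤ c_m`, `n²·m₁,k ≤ c₁`),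
and the TWO-RUN CLASS in node NE3's currency: RAW distances `‖Rb k − Rc k‖ ≤ ρ_k`, `‖Tb k − T k‖ ≤ τ_k` with `n·ρ_k ≤ c_ρ·θ^k`,
`τ_k ≤ c_τ·θ^k`, `0 ≤ θ < 1`.  THEN `TowerLimitRate (fun _ ↦ 1) 1 (fun k => effSc (L^k) M (Rc k) (T k) a₀) (cTwoRuns d L c_w′ c_a c_m c₁ c_ρ c_τ)
(max L⁻¹ θ)` (`2 ≤ L`).  NO leaf binder except UB⁺/P⁺ of the run-k data in leaf shape; NE3 NOT discharged; NE2 NOT proved. [folklore] -/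
theorem towerLimitRate_twoRuns_closed (hL : 2 ≤ L)
    -- run-k data: unit modulus, leaf UB⁺ and P⁺ in leaf shape
    (hT : ∀ k x, ‖T k x‖ = 1)
    (hUBk : ∀ k (μ : Tor M → ℂ), ∃ f, Qk (L ^ k) M (T k) f = μ ∧
      Sc (L ^ k) M (Rc k) f ≤ lamC d ((((L ^ k : ℕ)) : ℝ) * w' k) * nsq μ)
    (hPk : ∀ k f, qW (L ^ k) M f ≤ (1088 * (d : ℝ) + 128) * (Sc (L ^ k) M (Rc k) f + nsq (Qk (L ^ k) M (T k) f)))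
    -- run-(k+1)'s coarse partner and its canonical pair (the binders of `scalar_pair_closed_rel` at level k)
    (hTb : ∀ k x, ‖Tb k x‖ = 1) (hRb1 : ∀ k y μ, ‖Rb k y μ‖ = 1) (hR' : ∀ k x μ, ‖R' k x μ‖ ≤ 1) (hT'1 : ∀ k x, ‖T' k x‖ = 1)
    (hTcomp : ∀ k, T (k + 1) = compT (L ^ k) L M (Tb k) (T' k)) (hRtr : ∀ k, Rc (k + 1) = Rtr (L ^ k) L M (R' k))
    (hG : ∀ k x, ‖G k x‖ = 1) (hc : ∀ k z, ‖c k z‖ ≤ 1)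
    (hframe : ∀ k x μ, ‖G k (x + unitVec (fine (L ^ k) M) μ) - G k x * Rb k x μ‖ ≤ mG k)
    (hblock : ∀ k z j, ‖G k (bpt (L ^ k) M z j) - c k z * Tb k (bpt (L ^ k) M z j)‖ ≤ mB k)
    (hsmall : ∀ k, 16 * (d : ℝ) ^ 2 * ((((L ^ k : ℕ)) : ℝ) * mG k) ^ 2 + 4 * mB k ^ 2 ≤ 1 / 2)
    (hG' : ∀ k x, ‖G' k x‖ = 1) (hc' : ∀ k y, ‖c' k y‖ ≤ 1)
    (hframe' : ∀ k x μ, ‖G' k (x + unitVec (fine L (fine (L ^ k) M)) μ) - G' k x * R' k x μ‖ ≤ mG' k)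
    (hblock' : ∀ k y j, ‖G' k (bpt L (fine (L ^ k) M) y j) - c' k y * T' k (bpt L (fine (L ^ k) M) y j)‖ ≤ mB' k)
    (hsmall' : ∀ k, 16 * (d : ℝ) ^ 2 * ((L : ℝ) * mG' k) ^ 2 + 4 * mB' k ^ 2 ≤ 1 / 2)
    (hm : ∀ k, 0 ≤ m k) (hmis : ∀ k y μ j, ‖mis L (fine (L ^ k) M) (Rb k) (R' k) (T' k) y μ j‖ ≤ m k)
    (habsorb : ∀ k, 512 * (d : ℝ) ^ 2 * ((((L ^ k : ℕ)) : ℝ) * m k) ^ 2 ≤ 1 / 2)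
    (hTb₀ : ∀ k x, ‖Tb₀ k x‖ = 1) (hw : ∀ k, 0 ≤ w k)
    (hwin : ∀ k (y : Tor M) (j : Fin d → Fin (L ^ k)) (μ : Fin d), (j μ : ℕ) + 1 < L ^ k →
      ‖Rb k (bpt (L ^ k) M y j) μ * (starRingEnd ℂ) (Tb₀ k (bpt (L ^ k) M y j + unitVec (fine (L ^ k) M) μ)) * Tb₀ k (bpt (L ^ k) M y j) - 1‖
        ≤ w k)
    {γ : ℝ} (hγ : γ < 1) (hrel : ∀ k x, ‖Tb k x * (starRingEnd ℂ) (Tb₀ k x) - 1‖ ≤ γ)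
    (hw'0 : ∀ k, 0 ≤ w' k) (hw' : ∀ k, (4 + (((L ^ k : ℕ)) : ℝ) * w k) / (1 - γ) - 1 ≤ (((L ^ k : ℕ)) : ℝ) * w' k)
    (ha : ∀ k, 0 ≤ a k)
    (hP : ∀ k x μ ν, ‖Rb k x μ * Rb k (x + unitVec (fine (L ^ k) M) μ) ν - Rb k x ν * Rb k (x + unitVec (fine (L ^ k) M) ν) μ‖ ≤ a k)
    (hm₁ : ∀ k, 0 ≤ m₁ k)
    (hin : ∀ k (y : Tor (fine (L ^ k) M)) (j : Fin d → Fin L) (μ : Fin d), (j μ : ℕ) + 1 < L →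
      ‖R' k (bpt L (fine (L ^ k) M) y j) μ * (starRingEnd ℂ) (T' k (bpt L (fine (L ^ k) M) y j + unitVec (fine L (fine (L ^ k) M)) μ))
          * T' k (bpt L (fine (L ^ k) M) y j) - 1‖ ≤ m₁ k)
    (hcross : ∀ k (y : Tor (fine (L ^ k) M)) (j : Fin d → Fin L) (μ : Fin d), (j μ : ℕ) + 1 = L →
      ‖R' k (bpt L (fine (L ^ k) M) y j) μ * (starRingEnd ℂ) (T' k (bpt L (fine (L ^ k) M) y j + unitVec (fine L (fine (L ^ k) M)) μ))
          * T' k (bpt L (fine (L ^ k) M) y j) - Rb k y μ‖ ≤ m₁ k)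
    -- the pair's CLASS
    {cw ca cm c₁ : ℝ}
    (hwc : ∀ k, (((L ^ k : ℕ)) : ℝ) * w' k ≤ cw) (hac : ∀ k, a k * (((L ^ k : ℕ)) : ℝ) ^ 2 ≤ ca)
    (hmc : ∀ k, (((L ^ k : ℕ)) : ℝ) ^ 2 * m k ≤ cm) (hm₁c : ∀ k, (((L ^ k : ℕ)) : ℝ) ^ 2 * m₁ k ≤ c₁)
    -- the TWO-RUN CLASS (node NE3's currency): raw distances and their rate
    {θ cρ cτ : ℝ} (hθ0 : 0 ≤ θ) (hθ1 : θ < 1)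
    (hρ0 : ∀ k, 0 ≤ ρ k) (hρ : ∀ k y μ, ‖Rb k y μ - Rc k y μ‖ ≤ ρ k) (hρc : ∀ k, (((L ^ k : ℕ)) : ℝ) * ρ k ≤ cρ * θ ^ k)
    (hτ0 : ∀ k, 0 ≤ τ k) (hτ : ∀ k x, ‖Tb k x - T k x‖ ≤ τ k) (hτc : ∀ k, τ k ≤ cτ * θ ^ k)
    {a₀ : ℝ} (ha₀ : 0 < a₀) :
    TowerLimitRate (ι := fun _ => Tor M) (fun _ => (1 : Matrix (Tor M) (Tor M) ℂ)) 1
      (fun k => effSc (L ^ k) M (Rc k) (T k) a₀) (cTwoRuns d L cw ca cm c₁ cρ cτ) (max ((L : ℝ)⁻¹) θ) := by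
  have hL2 : (2 : ℝ) ≤ L := by exact_mod_cast hL
  have hL1 : (1 : ℝ) ≤ L := by linarith
  have hLinv0 : (0 : ℝ) ≤ (L : ℝ)⁻¹ := by positivity
  have hLinv1 : (L : ℝ)⁻¹ < 1 := inv_lt_one_of_one_lt₀ (by linarith)
  have hρ₀0 : 0 ≤ max ((L : ℝ)⁻¹) θ := le_max_of_le_left hLinv0
  have hρ₀1 : max ((L : ℝ)⁻¹) θ < 1 := max_lt hLinv1 hθ1
  have hca : 0 ≤ ca := le_trans (mul_nonneg (ha 0) (by positivity)) (hac 0)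
  have hcm : 0 ≤ cm := le_trans (mul_nonneg (by positivity) (hm 0)) (hmc 0)
  have hc₁ : 0 ≤ c₁ := le_trans (mul_nonneg (by positivity) (hm₁ 0)) (hm₁c 0)
  have hcw : 0 ≤ cw := le_trans (mul_nonneg (by positivity) (hw'0 0)) (hwc 0)
  have hcρ : 0 ≤ cρ := by
    have h := hρc 0; simp only [pow_zero, mul_one, Nat.cast_one, one_mul] at h; exact (hρ0 0).trans h
  have hcτ : 0 ≤ cτ := by have h := hτc 0; simp only [pow_zero, mul_one] at h; exact (hτ0 0).trans h
  have hCend : 0 ≤ cEnd d L cw ca cm c₁ := cEnd_nonneg d L hca hcm hc₁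
  have hClip : 0 ≤ cLip d cw cρ cτ := by
    unfold cLip; exact eFED_nonneg d (by positivity) (lamC_nonneg d _)
  have hC : 0 ≤ cTwoRuns d L cw ca cm c₁ cρ cτ := add_nonneg hCend hClip
  -- per-level UB⁺ (relative) and P⁺ for the coarse partner, in leaf shape
  have hUBb : ∀ k (μ : Tor M → ℂ), ∃ f, Qk (L ^ k) M (Tb k) f = μ ∧ Sc (L ^ k) M (Rb k) f ≤ lamC d ((((L ^ k : ℕ)) : ℝ) * w' k) * nsq μ := by
    intro k μ
    obtain ⟨f, hf, hb⟩ := exists_ub_scalarPair_rel_eff (L ^ k) M (hTb₀ k) (fun y ν => (hRb1 k y ν).le) (hw k) (hwin k) hγ (hrel k) (hw' k) μ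
    exact ⟨f, hf, by unfold lamC; exact hb⟩
  have hPb : ∀ k f, qW (L ^ k) M f ≤ (1088 * (d : ℝ) + 128) * (Sc (L ^ k) M (Rb k) f + nsq (Qk (L ^ k) M (Tb k) f)) :=
    fun k f => qW_le_coarse (L ^ k) M (hG k) (hc k) (hframe k) (hblock k) (hsmall k) f
  refine towerLimitRate_twoRuns_of_brackets L M Rc Rb T Tb R' T' hT hPk hTcomp hRtr ha₀ hC hρ₀0 hρ₀1
    (fun k => eLevel d L (((L ^ k : ℕ)) : ℝ) (w' k) (a k) (m k) (m₁ k)) (fun k => ePLevel d L (((L ^ k : ℕ)) : ℝ) (w' k) (a k) (m₁ k))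
    (fun k => eLip d (lamC d ((((L ^ k : ℕ)) : ℝ) * w' k))
      (Real.sqrt (d : ℝ) * ((((L ^ k : ℕ)) : ℝ) * ρ k) + Real.sqrt (lamC d ((((L ^ k : ℕ)) : ℝ) * w' k)) * τ k))
    (fun k => ?_) (fun k => ?_) (fun k μ => ?_) (fun k μ => ?_)
  -- rates
  · obtain ⟨hn1, hninv, ht0, ht1⟩ := level_facts L hL1 k
    have hθk0 : 0 ≤ θ ^ k := pow_nonneg hθ0 k
    have hθk1 : θ ^ k ≤ 1 := pow_le_one₀ hθ0 hθ1.le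
    have h1 := (level_defects_le (d := d) L hL1 k (hw'0 k) (hwc k) (ha k) (hac k) (hm k) (hmc k) (hm₁ k) (hm₁c k)).1
    have h2 := eLip_le (d := d) (by linarith) (hw'0 k) (hwc k) (hρ0 k) (hτ0 k) hθk0 hθk1 (hρc k) (hτc k)
    have hp1 : ((L : ℝ)⁻¹) ^ k ≤ (max ((L : ℝ)⁻¹) θ) ^ k := pow_le_pow_left₀ hLinv0 (le_max_left _ _) k
    have hp2 : θ ^ k ≤ (max ((L : ℝ)⁻¹) θ) ^ k := pow_le_pow_left₀ hθ0 (le_max_right _ _) k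
    unfold cTwoRuns
    nlinarith [mul_le_mul_of_nonneg_left hp1 hCend, mul_le_mul_of_nonneg_left hp2 hClip]
  · obtain ⟨hn1, hninv, ht0, ht1⟩ := level_facts L hL1 k
    have hθk0 : 0 ≤ θ ^ k := pow_nonneg hθ0 k
    have hθk1 : θ ^ k ≤ 1 := pow_le_one₀ hθ0 hθ1.le
    have h1 := (level_defects_le (d := d) L hL1 k (hw'0 k) (hwc k) (ha k) (hac k) (hm k) (hmc k) (hm₁ k) (hm₁c k)).2
    have h2 := eLip_le (d := d) (by linarith) (hw'0 k) (hwc k) (hρ0 k) (hτ0 k) hθk0 hθk1 (hρc k) (hτc k)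
    have hp1 : ((L : ℝ)⁻¹) ^ k ≤ (max ((L : ℝ)⁻¹) θ) ^ k := pow_le_pow_left₀ hLinv0 (le_max_left _ _) k
    have hp2 : θ ^ k ≤ (max ((L : ℝ)⁻¹) θ) ^ k := pow_le_pow_left₀ hθ0 (le_max_right _ _) k
    unfold cTwoRuns
    nlinarith [mul_le_mul_of_nonneg_left hp1 hCend, mul_le_mul_of_nonneg_left hp2 hClip]
  -- the canonical-pair bracket of run k+1 over its coarse partner
  · have h := scalar_pair_closed_rel (L ^ k) L M (hG k) (hc k) (hframe k) (hblock k) (hsmall k) (hG' k) (hc' k) (hframe' k) (hblock' k)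
      (hsmall' k) (hR' k) (hT'1 k) (hm k) (hmis k) (habsorb k) (hTb k) (hRb1 k) (hTb₀ k) (hw k) (hwin k) hγ (hrel k) (hw'0 k) (hw' k)
      (ha k) (hP k) (hm₁ k) (hin k) (hcross k) μ
    simp only [eLevel, ePLevel, lamLevel, lamF, lamC, cR, eFED, eONE, eUB, delta, eps1, deltaP]
    simpa only using h
  -- the two-runs face by constraint repair
  · have h := scalar_repair_abs (L ^ k) M (hρ0 k) (hρ k) (hτ0 k) (hτ k) (lamC_nonneg d _) (by positivity) (hUBk k) (hPk k) (hUBb k) (hPb k) μ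
    unfold eLip
    exact h

end Closed

end Summit.QuantumFields.BalabanUV.T4Continuum.VariationalCovariantTwoRunsEnd

end
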